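import Mathlib
import Summits.CriticalPhenomena.PercolationContinuityZ3.Theorems.PercNearOneGluingNoHeavyLowerTailOrientedAntipodalHallAcyclic

/-!
# Slack in the oriented antipodal Hall count: a cyclic triple of bads has at least FOUR goods above it

Helper file for crux `stmt-CriticalPhenomena-4575` (`NoHeavyLowerTail`, route `PercNearOneGluingNoHeavy`),
new-inequality factory seat `prim-ineq-gen-3` (gen 15).  Everything here is PROVED.

Setting of `…OrientedAntipodalHall`: `f : Finset α → Lab k` monotone on subsets of `S`; a good set is `U ⊆ S` with
`f U = A`, `f (S \ U) = B`; an antipodal bad of type `(p,q)` is `X ⊆ S` with `f X = C_p`, `f (S \ X) = C_q`.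
Three bads `X₁, X₂, X₃` of types `(i,j), (j,l), (l,i)` (`i, j, l` distinct) form a CYCLIC TRIPLE — the smallest
configuration whose type digraph is a directed cycle, i.e. the smallest instance of the regime where every linear
certificate for Conjecture O_k fails (memo FINDINGS-gen15 F15-2 in HOME `run/shared/lean/prim/prim-ineq-gen-3/`).

**Theorem (`four_le_card_goods_above_cyclic_triple`).**  At least four good sets lie above a cyclic triple — one
more than Hall's condition needs (surplus ≥ 1).  Proof: for every point `x ∈ S` outside `X₁ ∩ X₂ ∩ X₃` the set
`S.erase x` is a good set above one of the three bads (a case analysis on which of the bads contain `x`, using only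
monotonicity and the incomparability of distinct petals), `S` itself is one, and the labels force three distinct
such points (`S \ X₂ ⊄ X₁`, `S \ X₁ ⊄ S \ X₂`, `S \ X₂ ⊄ S \ X₁`).  This is the first proved instance of the 'slack'
phenomenon of FINDINGS-gen15 F15-3/F15-4 (Hall-tight families are never cyclic in the five-point census).
-/

namespace Summit.CriticalPhenomena.PercolationContinuityZ3.Theorems

namespace OrientedAntipodalHall

open Finset AntipodalStrongHarris AntipodalStrongHarris.Lab

variable {α : Type*} [DecidableEq α] {k : ℕ}

/-- **A cyclic triple of antipodal bads has at least four good sets above it** (surplus ≥ 1 in the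
oriented antipodal Hall count). -/
theorem four_le_card_goods_above_cyclic_triple (S : Finset α) {f : Finset α → Lab k}
    (hf : ∀ ⦃X Y : Finset α⦄, X ⊆ Y → f X ≤ f Y) {i j l : Fin k} (hij : i ≠ j) (hjl : j ≠ l) (hil : i ≠ l)
    {X₁ X₂ X₃ : Finset α} (h₁S : X₁ ⊆ S) (h₂S : X₂ ⊆ S) (h₃S : X₃ ⊆ S)
    (h₁ : f X₁ = petal i) (h₁' : f (S \ X₁) = petal j) (h₂ : f X₂ = petal j) (h₂' : f (S \ X₂) = petal l)
    (h₃ : f X₃ = petal l) (h₃' : f (S \ X₃) = petal i) :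
    4 ≤ #{U ∈ S.powerset | f U = top ∧ f (S \ U) = bot ∧ (X₁ ⊆ U ∨ X₂ ⊆ U ∨ X₃ ⊆ U)} := by
  classical
  set G : Finset (Finset α) :=
    {U ∈ S.powerset | f U = top ∧ f (S \ U) = bot ∧ (X₁ ⊆ U ∨ X₂ ⊆ U ∨ X₃ ⊆ U)} with hG
  have memG : ∀ U : Finset α, U ⊆ S → f U = top → f (S \ U) = bot →
      (X₁ ⊆ U ∨ X₂ ⊆ U ∨ X₃ ⊆ U) → U ∈ G := by
    intro U hUS htop hbot hX
    rw [hG, mem_filter, mem_powerset]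
    exact ⟨hUS, htop, hbot, hX⟩
  -- lower bounds `petal _ ≤ f Y` from `X_m ⊆ Y` / `S \ X_m ⊆ Y`, upper bounds `f Y ≤ petal _` from `Y ⊆ X_m` / `Y ⊆ S \ X_m`
  have lo : ∀ {Y Z : Finset α} {c : Lab k}, f Z = c → Z ⊆ Y → c ≤ f Y := by
    intro Y Z c hZ hZY; rw [← hZ]; exact hf hZY
  have up : ∀ {Y Z : Finset α} {c : Lab k}, f Z = c → Y ⊆ Z → f Y ≤ c := by
    intro Y Z c hZ hYZ; rw [← hZ]; exact hf hYZ
  -- `S` is a good above `X₁`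
  have hSG : S ∈ G := by
    refine memG S subset_rfl (eq_top_of_petal_le hij (lo h₁ h₁S) (lo h₂ h₂S)) ?_ (Or.inl h₁S)
    rw [sdiff_self]
    exact eq_bot_of_le_petal hjl (up h₁' (empty_subset _)) (up h₂' (empty_subset _))
  -- containment helpers
  have sub_erase : ∀ {Y : Finset α} {x : α}, Y ⊆ S → x ∉ Y → Y ⊆ S.erase x := by
    intro Y x hYS hx y hy
    exact mem_erase.mpr ⟨fun h => hx (h ▸ hy), hYS hy⟩
  have sdiff_erase_eq : ∀ {x : α}, x ∈ S → S \ S.erase x = {x} := by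
    intro x hx
    ext y
    simp only [mem_sdiff, mem_erase, not_and, mem_singleton]
    constructor
    · intro h
      by_contra hyx
      exact (h.2 hyx) h.1 |>.elim
    · rintro rfl
      exact ⟨hx, fun h => absurd rfl h⟩
  -- the key step: for `x ∈ S` outside `X₁ ∩ X₂ ∩ X₃`, `S.erase x` is a good above one of the bads
  have hErase : ∀ x ∈ S, ¬ (x ∈ X₁ ∧ x ∈ X₂ ∧ x ∈ X₃) → S.erase x ∈ G := by
    intro x hxS hnot
    have hES : S.erase x ⊆ S := erase_subset x S
    have hsing : ∀ {Y : Finset α}, x ∈ Y → ({x} : Finset α) ⊆ Y := fun h => singleton_subset_iff.mpr h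
    -- membership of `x` in the complements
    have cU : ∀ {X : Finset α}, x ∉ X → x ∈ S \ X := fun h => mem_sdiff.mpr ⟨hxS, h⟩
    have Usub : ∀ {X : Finset α}, x ∈ X → S \ X ⊆ S.erase x :=
      fun h => sub_erase sdiff_subset (fun h' => (mem_sdiff.mp h').2 h)
    by_cases hx1 : x ∈ X₁
    · by_cases hx2 : x ∈ X₂
      · have hx3 : x ∉ X₃ := fun h => hnot ⟨hx1, hx2, h⟩
        -- x ∈ S \ X₃ (petal i) and x ∈ X₂ (petal j): f {x} = B;  S.erase x ⊇ X₃ (petal l), ⊇ S \ X₁ (petal j): top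
        refine memG _ hES (eq_top_of_petal_le hjl.symm (lo h₃ (sub_erase h₃S hx3)) (lo h₁' (Usub hx1))) ?_
          (Or.inr (Or.inr (sub_erase h₃S hx3)))
        rw [sdiff_erase_eq hxS]
        exact eq_bot_of_le_petal hij (up h₃' (hsing (cU hx3))) (up h₂ (hsing hx2))
      · by_cases hx3 : x ∈ X₃
        · -- x ∈ S \ X₂ (petal l), x ∈ X₁ (petal i): B;  S.erase x ⊇ X₂ (petal j), ⊇ S \ X₃ (petal i): top
          refine memG _ hES (eq_top_of_petal_le hij.symm (lo h₂ (sub_erase h₂S hx2)) (lo h₃' (Usub hx3))) ?_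
            (Or.inr (Or.inl (sub_erase h₂S hx2)))
          rw [sdiff_erase_eq hxS]
          exact eq_bot_of_le_petal hil.symm (up h₂' (hsing (cU hx2))) (up h₁ (hsing hx1))
        · -- x ∈ S \ X₂ (petal l), x ∈ S \ X₃ (petal i): B;  S.erase x ⊇ X₂ (petal j), ⊇ X₃ (petal l): top
          refine memG _ hES (eq_top_of_petal_le hjl (lo h₂ (sub_erase h₂S hx2)) (lo h₃ (sub_erase h₃S hx3))) ?_
            (Or.inr (Or.inl (sub_erase h₂S hx2)))
          rw [sdiff_erase_eq hxS]
          exact eq_bot_of_le_petal hil.symm (up h₂' (hsing (cU hx2))) (up h₃' (hsing (cU hx3)))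
    · by_cases hx2 : x ∈ X₂
      · by_cases hx3 : x ∈ X₃
        · -- x ∈ S \ X₁ (petal j), x ∈ X₃ (petal l): B;  S.erase x ⊇ X₁ (petal i), ⊇ S \ X₂ (petal l): top
          refine memG _ hES (eq_top_of_petal_le hil (lo h₁ (sub_erase h₁S hx1)) (lo h₂' (Usub hx2))) ?_
            (Or.inl (sub_erase h₁S hx1))
          rw [sdiff_erase_eq hxS]
          exact eq_bot_of_le_petal hjl (up h₁' (hsing (cU hx1))) (up h₃ (hsing hx3))
        · -- x ∈ S \ X₁ (petal j), x ∈ S \ X₃ (petal i): B;  S.erase x ⊇ X₁ (petal i), ⊇ X₃ (petal l): top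
          refine memG _ hES (eq_top_of_petal_le hil (lo h₁ (sub_erase h₁S hx1)) (lo h₃ (sub_erase h₃S hx3))) ?_
            (Or.inl (sub_erase h₁S hx1))
          rw [sdiff_erase_eq hxS]
          exact eq_bot_of_le_petal hij.symm (up h₁' (hsing (cU hx1))) (up h₃' (hsing (cU hx3)))
      · -- x ∈ S \ X₁ (petal j), x ∈ S \ X₂ (petal l): B;  S.erase x ⊇ X₁ (petal i), ⊇ X₂ (petal j): top
        refine memG _ hES (eq_top_of_petal_le hij (lo h₁ (sub_erase h₁S hx1)) (lo h₂ (sub_erase h₂S hx2))) ?_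
          (Or.inl (sub_erase h₁S hx1))
        rw [sdiff_erase_eq hxS]
        exact eq_bot_of_le_petal hjl (up h₁' (hsing (cU hx1))) (up h₂' (hsing (cU hx2)))
  -- three distinct points outside `X₁ ∩ X₂ ∩ X₃`
  have not_sub : ∀ {Y Z : Finset α} {p q : Fin k}, f Y = petal p → f Z = petal q → p ≠ q → ¬ Y ⊆ Z := by
    intro Y Z p q hY hZ hpq hYZ
    have h := hf hYZ
    rw [hY, hZ, petal_le_petal_iff] at h
    exact hpq h
  obtain ⟨a, haU₂, haX₁⟩ := not_subset.mp (not_sub h₂' h₁ hil.symm)      -- a ∈ S \ X₂, a ∉ X₁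
  obtain ⟨d, hdU₁, hdU₂⟩ := not_subset.mp (not_sub h₁' h₂' hjl)          -- d ∈ S \ X₁, d ∉ S \ X₂
  obtain ⟨e, heU₂, heU₁⟩ := not_subset.mp (not_sub h₂' h₁' hjl.symm)     -- e ∈ S \ X₂, e ∉ S \ X₁
  have haS : a ∈ S := (mem_sdiff.mp haU₂).1
  have haX₂ : a ∉ X₂ := (mem_sdiff.mp haU₂).2
  have hdS : d ∈ S := (mem_sdiff.mp hdU₁).1
  have hdX₁ : d ∉ X₁ := (mem_sdiff.mp hdU₁).2
  have hdX₂ : d ∈ X₂ := by by_contra h; exact hdU₂ (mem_sdiff.mpr ⟨hdS, h⟩)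
  have heS : e ∈ S := (mem_sdiff.mp heU₂).1
  have heX₂ : e ∉ X₂ := (mem_sdiff.mp heU₂).2
  have heX₁ : e ∈ X₁ := by by_contra h; exact heU₁ (mem_sdiff.mpr ⟨heS, h⟩)
  have had : a ≠ d := fun h => haX₂ (h ▸ hdX₂)
  have hae : a ≠ e := fun h => haX₁ (h ▸ heX₁)
  have hde : d ≠ e := fun h => hdX₁ (h ▸ heX₁)
  have hGa : S.erase a ∈ G := hErase a haS (fun h => haX₁ h.1)
  have hGd : S.erase d ∈ G := hErase d hdS (fun h => hdX₁ h.1)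
  have hGe : S.erase e ∈ G := hErase e heS (fun h => heX₂ h.2.1)
  -- the four goods `S, S.erase a, S.erase d, S.erase e` are distinct
  have neS : ∀ {x : α}, x ∈ S → S.erase x ≠ S := fun hx h => (notMem_erase _ S) (h.symm ▸ hx)
  have neE : ∀ {x y : α}, x ∈ S → x ≠ y → S.erase x ≠ S.erase y :=
    fun hx hxy h => hxy ((erase_inj S hx).mp h)
  have hsub4 : ({S.erase a, S.erase d, S.erase e, S} : Finset (Finset α)) ⊆ G := by
    intro U hU
    simp only [mem_insert, mem_singleton] at hU
    rcases hU with rfl | rfl | rfl | rfl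
    exacts [hGa, hGd, hGe, hSG]
  have hcard4 : #({S.erase a, S.erase d, S.erase e, S} : Finset (Finset α)) = 4 := by
    rw [card_insert_of_notMem, card_insert_of_notMem, card_insert_of_notMem, card_singleton]
    · simpa using neS heS
    · simp only [mem_insert, mem_singleton, not_or]
      exact ⟨neE hdS hde, neS hdS⟩
    · simp only [mem_insert, mem_singleton, not_or]
      exact ⟨neE haS had, neE haS hae, neS haS⟩
  calc 4 = #({S.erase a, S.erase d, S.erase e, S} : Finset (Finset α)) := hcard4.symm
    _ ≤ #G := card_le_card hsub4

end OrientedAntipodalHall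

end Summit.CriticalPhenomena.PercolationContinuityZ3.Theorems
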